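import Summits.AtomisticToContinuum.HydrodynamicLimit.Theorems.JParityClosureLocalSecondLawContactDefs
import Summits.AtomisticToContinuum.HydrodynamicLimit.Theorems.JParityClosureLocalSecondLawContactKernel
import Literature.Analysis.FluidPDE.CollisionWeakForm

/-!
# Ensemble vocabulary of the line `contact-asymmetry-information` for the crux `LocalSecondLaw`
(stmt-AtomisticToContinuum-13081) — part C: the contact bundle

Theorems-side copy (texts byte-identical, only the namespace differs) of the CONTACT-BUNDLE objects of the registered
skeleton `Cruxes/LocalSecondLaw/Lines/contact_asymmetry_information.lean`: the bundle `[0,τ] × 𝕋³ × (V3 × V3) × 𝕊²` with its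
reference measure `bundleMeasure`, the measure-preserving involution `Rhat` (`Rhat_involutive`, `measurePreserving_Rhat`),
contact points (`dirOf`, `dirTo`, `contactPt`) and the per-particle collision sum `pcollSum`, contact densities
`IsContactDensity`, the weighted objects `phiTilde/bRef/qW/prodR/asymR`, `Admissible`, `RelOddChaosPtwise` (+
`relOddChaosPtwise_of_invariant`), and the two instantiations of the abstract kernel on the bundle,
`prodR_ge_of_relativeOddChaos` and `asymR_le_of_relativeOddChaos` (registered anchor `contactBundle_budget`).  Stubs S and K1
of the line are statements over parts A + C.

References: H. Spohn, *Large Scale Dynamics of Interacting Particles* (1991), Part I §3; P. Résibois, J. Stat. Phys. 19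
(1978) 593.  Lead seat prover-line-stmt-AtomisticToContinuum-13081-a5-0 (vocabulary landing; texts by the crux-plan seat).
-/

noncomputable section

open scoped BigOperators Topology Classical MeasureTheory ENNReal InnerProductSpace
open Filter Set MeasureTheory Function
open Literature.MathematicalPhysics.KineticTheory
open Literature.Analysis.FluidPDE
open Summit.AtomisticToContinuum.HydrodynamicLimit.Theorems.LocalSecondLawNegative
open Summit.AtomisticToContinuum.HydrodynamicLimit.Theorems.LocalSecondLawLedger

namespace Summit.AtomisticToContinuum.HydrodynamicLimit.Theorems.LocalSecondLawContact

variable {N : ℕ}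

/-- The CONTACT BUNDLE `[0,τ] × 𝕋³ × (V3 × V3) × 𝕊²`: time, position of the particle, (its PRE-collisional velocity, the
partner's PRE-collisional velocity), unit direction from the particle to its partner (partner at `x + εω`). -/
abbrev Bundle : Type := ℝ × T3 × ((V3 × V3) × Metric.sphere (0 : V3) 1)

/-- Reference measure of the bundle on `[0,τ]`: `ds dx dv dw dω`. -/
def bundleMeasure (τ : ℝ) : Measure Bundle :=
  ((volume : Measure ℝ).restrict (Set.Icc 0 τ)).prod
    ((volume : Measure T3).prod (((volume : Measure V3).prod (volume : Measure V3)).prod sphereMeasure))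

/-- **The bundle involution** `R̂(s, x, (v,w), ω) = (s, x, collide ω (v,w), −ω)`: the OUTGOING pair of the collision READ
BACKWARDS as an incoming pair at the same point (the card's `R`; maps incoming configurations to incoming ones). -/
def Rhat (p : Bundle) : Bundle :=
  (p.1, p.2.1, (collide p.2.2.2 p.2.2.1, -p.2.2.2))

/-- `R̂` is an involution (`collide (−ω) = collide ω` and `collide ω ∘ collide ω = id`). -/
theorem Rhat_involutive : Involutive Rhat := by
  intro p
  obtain ⟨s, x, pvw, ω⟩ := p
  simp only [Rhat, collide_neg_dir, Literature.MathematicalPhysics.KineticTheory.collide_collide, neg_neg]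

/-- `R̂` preserves the bundle measure: it is `id × id × (T₂ ∘ T₁)` with the tree's measure-preserving
`T₁ : ((v,w),ω) ↦ ((collide ω (v,w)).swap, ω)` and `T₂ : ((v,w),ω) ↦ ((v,w).swap, −ω)`. -/
theorem measurePreserving_Rhat (τ : ℝ) : MeasurePreserving Rhat (bundleMeasure τ) (bundleMeasure τ) := by
  haveI := isFiniteMeasure_sphereMeasure (E := V3)
  haveI hsf : SFinite (sphereMeasure : Measure (Metric.sphere (0 : V3) 1)) := inferInstance
  have hT : MeasurePreserving
      (fun q : (V3 × V3) × Metric.sphere (0 : V3) 1 => (collide q.2 q.1, -q.2))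
      (((volume : Measure V3).prod (volume : Measure V3)).prod sphereMeasure)
      (((volume : Measure V3).prod (volume : Measure V3)).prod sphereMeasure) := by
    have h := (measurePreserving_swap_negDir (E := V3)).comp (measurePreserving_collideSwap_prod (E := V3))
    have hfun : ((fun q : (V3 × V3) × Metric.sphere (0 : V3) 1 => (q.1.swap, -q.2)) ∘
        fun q => ((collide q.2 q.1).swap, q.2)) =
        (fun q : (V3 × V3) × Metric.sphere (0 : V3) 1 => (collide q.2 q.1, -q.2)) := by
      funext q; simp [Function.comp, Prod.swap_swap]
    rw [hfun] at h
    exact h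
  have hId1 : MeasurePreserving (id : ℝ → ℝ) ((volume : Measure ℝ).restrict (Set.Icc 0 τ))
      ((volume : Measure ℝ).restrict (Set.Icc 0 τ)) := MeasurePreserving.id _
  have hId2 : MeasurePreserving (id : T3 → T3) (volume : Measure T3) (volume : Measure T3) :=
    MeasurePreserving.id _
  have h23 := hId2.prod hT
  have h := hId1.prod h23
  have hR : Rhat = Prod.map id (Prod.map id
      (fun q : (V3 × V3) × Metric.sphere (0 : V3) 1 => (collide q.2 q.1, -q.2))) := by
    funext p; rfl
  rw [hR]
  exact h

/-- A fixed point of the unit sphere (junk direction off genuine contacts). -/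
def defaultDir : Metric.sphere (0 : V3) 1 :=
  ⟨EuclideanSpace.single 0 1, by simp⟩

/-- Unit direction of a vector, as a point of the sphere (junk `defaultDir` unless `‖u‖ = 1`). -/
def dirOf (u : V3) : Metric.sphere (0 : V3) 1 :=
  if h : ‖u‖ = 1 then ⟨u, by simp [h]⟩ else defaultDir

/-- Unit direction FROM particle `i` TO particle `j`: `ε⁻¹ · sepVec xⱼ xᵢ` (so that the partner sits at `xᵢ + εω`). -/
def dirTo (ε : ℝ) (w : Phase N) (i j : Fin (N + 1)) : Metric.sphere (0 : V3) 1 :=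
  dirOf (ε⁻¹ • (Torus.geometry (Fin 3)).sepVec (w j).1 (w i).1)

/-- The bundle point of the ordered contact pair `(i, j)` at time `s`: `(s, xᵢ, (vᵢ⁻, vⱼ⁻), ω_{i→j})` (pre-collisional
velocities read off the post-collisional state by the reflection involution, `vin`). -/
def contactPt (ε : ℝ) (s : ℝ) (w : Phase N) (i j : Fin (N + 1)) : Bundle :=
  (s, (w i).1, (vin w i j, dirTo ε w i j))

/-- The per-particle collision sum `(N+1)⁻¹ ∑_{collision times s ∈ (0,τ]} ∑_{ordered contact pairs (i,j)} F(contact point)`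
(contact test verbatim that of `collSum` / cruxes 2–4; NO factor `ε`: this counts entropy jumps, not a kinetic rate). -/
def pcollSum (σ τ : ℝ) (Φ : Flow σ N) (z : Phase N) (F : Bundle → ℝ) : ℝ :=
  (N + 1 : ℝ)⁻¹ *
    ∑ᶠ (s : ℝ) (_ : s ∈ collisionTimes (Torus.geometry (Fin 3)) (hsDiameter σ N) (fun t => Φ.flow t z) ∩
        Set.Ioc 0 τ),
      ∑ i : Fin (N + 1), ∑ j : Fin (N + 1),
        (if i ≠ j ∧ ‖(Torus.geometry (Fin 3)).sepVec (Φ.flow s z i).1 (Φ.flow s z j).1‖ = hsDiameter σ N then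
          F (contactPt (hsDiameter σ N) s (Φ.flow s z) i j) else 0)

/-- `q` IS A CONTACT DENSITY of the law `ν` on `[0,τ]`: the density, w.r.t. the bundle measure, of the EXPECTED
EMPIRICAL COLLISION MEASURE (ordered pairs, pre-collisional velocities), characterised against bounded measurable test
functions — the flux-weighted incoming contact pair marginal `|g·ω| f₂(s; x, v; x+εω, w)` times the rate normalisation,
with no trace taken. -/
def IsContactDensity (τ : ℝ) (ν : Measure (Phase N)) {σ : ℝ} (Φ : Flow σ N) (q : Bundle → ℝ) : Prop :=
  (∀ p, 0 ≤ q p) ∧ Measurable q ∧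
    ∀ F : Bundle → ℝ, Measurable F → (∃ C : ℝ, ∀ p, |F p| ≤ C) →
      Integrable (fun z => pcollSum σ τ Φ z F) ν ∧
        ∫ z, pcollSum σ τ Φ z F ∂ν = ∫ p, F p * q p ∂(bundleMeasure τ)

/-- Cone-smeared test function `φ̃(s, y) = ∫ b_r(y, x) φ(s, x) dx` (the smearing TRANSPOSED onto `φ`: `φ̃ ≥ 0`, smooth). -/
def phiTilde (r : ℝ) (φ : ℝ → T3 → ℝ) (s : ℝ) (y : T3) : ℝ :=
  ∫ x : T3, cone r y x * φ s x

/-- The reference pair density `b(s, x, (v,w), ω) = f(s, x, v) · f(s, x + εω, w)` (product of one-particle densities at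
the two centres). -/
def bRef (ε : ℝ) (f : Pt1 → ℝ) (p : Bundle) : ℝ :=
  f (p.1, p.2.1, p.2.2.1.1) * f (p.1, p.2.1 + tproj (ε • (p.2.2.2 : V3)), p.2.2.1.2)

/-- The `φ̃`-weighted contact density `q̃ = φ̃(s,x) q` (the weight is `R̂`-invariant, so it rides inside `q`). -/
def qW (r : ℝ) (φ : ℝ → T3 → ℝ) (q : Bundle → ℝ) (p : Bundle) : ℝ :=
  phiTilde r φ p.1 p.2.1 * q p

/-- **`P_R` — half the booked production on the contact bundle**: `½ ∫ φ̃ q (log b − log b∘R̂)`; the exact collision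
term of the smeared first-marginal entropy balance is `P_R` + (Résibois offset + collisional entropy-flux pairing). -/
def prodR (σ r τ : ℝ) (φ : ℝ → T3 → ℝ) (q : Bundle → ℝ) (f : Pt1 → ℝ) (N : ℕ) : ℝ :=
  (1 / 2 : ℝ) * bookedProduction (bundleMeasure τ) Rhat (qW r φ q) (bRef (hsDiameter σ N) f)

/-- Asymmetry information of the weighted contact law, `A = KL(q̃R̂ ‖ q̃) ≥ 0`. -/
def asymR (r τ : ℝ) (φ : ℝ → T3 → ℝ) (q : Bundle → ℝ) : ℝ :=
  asymmetryInfo (bundleMeasure τ) Rhat (qW r φ q)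

/-- ADMISSIBILITY of a pair `(q, f)` for the kernel identity: the four integrabilities on the bundle and the pointwise
Gibbs condition (`q̃`, `q̃∘R̂` vanish together a.e. — true for contact densities, which are positive exactly on the
incoming set, an `R̂`-invariant set). Regularity, not dynamics. -/
def Admissible (σ r τ : ℝ) (φ : ℝ → T3 → ℝ) (q : Bundle → ℝ) (f : Pt1 → ℝ) (N : ℕ) : Prop :=
  Integrable (fun p => qW r φ q p * Real.log (qW r φ q p)) (bundleMeasure τ) ∧
  Integrable (fun p => qW r φ q p * Real.log (bRef (hsDiameter σ N) f p)) (bundleMeasure τ) ∧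
  Integrable (fun p => qW r φ q (Rhat p) * Real.log (qW r φ q p)) (bundleMeasure τ) ∧
  Integrable (fun p => qW r φ q (Rhat p) * Real.log (bRef (hsDiameter σ N) f p)) (bundleMeasure τ) ∧
  (∀ᵐ p ∂(bundleMeasure τ), 0 ≤ qW r φ q p ∧ (qW r φ q p = 0 ↔ qW r φ q (Rhat p) = 0))

/-- **Pointwise one-sided RELATIVE ODD CHAOS at level `κ` with slack `e`** (the typed content of K1): a.e. on the bundle,
the `R̂`-ODD part of the log pair-correlation `ψ = log q̃ − log b` is bounded ON THE HARMFUL SIDE by `κ` times the `R̂`-odd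
part of `log q̃`, in the product form that is insensitive to the near-reversible zero set:
`(q̃R̂ − q̃)·ψ_odd ≥ −κ·½(q̃R̂ − q̃)(log q̃R̂ − log q̃) − e`. -/
def RelOddChaosPtwise (σ r τ : ℝ) (φ : ℝ → T3 → ℝ) (q : Bundle → ℝ) (f : Pt1 → ℝ) (N : ℕ) (κ : ℝ)
    (e : Bundle → ℝ) : Prop :=
  ∀ᵐ p ∂(bundleMeasure τ),
    -(κ * (jeffreysIntegrand Rhat (qW r φ q) p / 2)) - e p ≤
      (qW r φ q (Rhat p) - qW r φ q p) * oddPart Rhat (logCorr (qW r φ q) (bRef (hsDiameter σ N) f)) p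

/-- TIGHTNESS SANITY (`not_localSecondLawGapAt` built in): at an `R̂`-INVARIANT weighted contact law — global or local
equilibrium with or without drift/shear, static (R-even) correlations included — both sides of K1 vanish identically, so K1
holds at every level `κ` with ZERO slack; no positive gap is ever produced. -/
theorem relOddChaosPtwise_of_invariant {σ r τ : ℝ} {φ : ℝ → T3 → ℝ} {q : Bundle → ℝ} {f : Pt1 → ℝ}
    (hinv : ∀ p, qW r φ q (Rhat p) = qW r φ q p) (κ : ℝ) :
    RelOddChaosPtwise σ r τ φ q f N κ (fun _ => 0) := by
  refine ae_of_all _ fun p => ?_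
  simp [jeffreysIntegrand, hinv p]

/-- **The production sign from pointwise relative odd chaos** (instantiation of the kernel on the real contact bundle;
PROVED): admissibility + K1 at level `κ ≤ 1` with slack `∫e ≤ η` give `P_R ≥ −η/2`. -/
theorem prodR_ge_of_relativeOddChaos {σ r τ : ℝ} {φ : ℝ → T3 → ℝ} {q : Bundle → ℝ} {f : Pt1 → ℝ}
    (hAdm : Admissible σ r τ φ q f N) {κ : ℝ} (hκ : κ ≤ 1) {e : Bundle → ℝ}
    (he : Integrable e (bundleMeasure τ)) {η : ℝ} (heη : ∫ p, e p ∂(bundleMeasure τ) ≤ η)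
    (hK1 : RelOddChaosPtwise σ r τ φ q f N κ e) :
    -(η / 2) ≤ prodR σ r τ φ q f N := by
  obtain ⟨i1, i2, i3, i4, hq⟩ := hAdm
  have h := bookedProduction_ge_of_pointwise (measurePreserving_Rhat τ) Rhat_involutive i1 i2 i3 i4 hq hκ he hK1
  unfold prodR
  linarith

/-- **The Maxwellisation budget on the contact bundle** (K1 read upward; PROVED): admissibility + K1 at level `κ` with slack
`∫e ≤ η` give `(1 − κ)·A ≤ 2·P_R + η` — with `κ < 1` uniform in `N` (as K1 is typed) and `P_R` bounded by the kinetic-entropy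
drop, the asymmetry information of the contacts is an `O(1)` quantity while the bundle mass diverges like `τ/Kn`: the input of
stub M's intended derivation. -/
theorem asymR_le_of_relativeOddChaos {σ r τ : ℝ} {φ : ℝ → T3 → ℝ} {q : Bundle → ℝ} {f : Pt1 → ℝ}
    (hAdm : Admissible σ r τ φ q f N) {κ : ℝ} {e : Bundle → ℝ}
    (he : Integrable e (bundleMeasure τ)) {η : ℝ} (heη : ∫ p, e p ∂(bundleMeasure τ) ≤ η)
    (hK1 : RelOddChaosPtwise σ r τ φ q f N κ e) :
    (1 - κ) * asymR r τ φ q ≤ 2 * prodR σ r τ φ q f N + η := by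
  obtain ⟨i1, i2, i3, i4, -⟩ := hAdm
  have h := asymmetryInfo_le_of_pointwise (measurePreserving_Rhat τ) Rhat_involutive i1 i2 i3 i4 he hK1
  unfold prodR asymR
  linarith

/-- Registered anchor of this vocabulary file (`contactBundle_budget`): the Maxwellisation budget on the contact bundle as a
closed statement. -/
theorem contactBundle_budget : ∀ {N : ℕ} {σ r τ : ℝ} {φ : ℝ → T3 → ℝ} {q : Bundle → ℝ} {f : Pt1 → ℝ}, Admissible σ r τ φ q f N → ∀ {κ : ℝ} {e : Bundle → ℝ}, Integrable e (bundleMeasure τ) → ∀ {η : ℝ}, ∫ p, e p ∂(bundleMeasure τ) ≤ η → RelOddChaosPtwise σ r τ φ q f N κ e → (1 - κ) * asymR r τ φ q ≤ 2 * prodR σ r τ φ q f N + η :=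
  fun hAdm _ _ he _ heη hK1 => asymR_le_of_relativeOddChaos hAdm he heη hK1


end Summit.AtomisticToContinuum.HydrodynamicLimit.Theorems.LocalSecondLawContact

end
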